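import Mathlib.GroupTheory.OrderOfElement
import Mathlib.Algebra.Group.Subgroup.Basic
import Mathlib.Algebra.Module.Basic
import Mathlib.Tactic
import Literature.NumberTheory.EllipticCurves.LeadingTermHeegnerProofs
import HarnessLib

/-!
# Crux `PrintCf2.SplitBadTwoRankOneOfFacts` (stmt-BirchSwinnertonDyer-20368), road α v10.3 — S3c (R-BV) factor (F1), GLOBAL HALF, file 1:
# THE MORDELL–WEIL LATTICE OF A CM TWIST OVER `K` IS `O_K · P` UP TO THE ODD INDEX `7` — pure algebra of `(E(K), π, c, P)`

Cell `bsd-print-cf2`, width seat `bsd-line-cf2-p1-w6` g3 (prover-bsd-line-cf2-p1-w6-g3-0); memo `Cruxes/SplitBadTwoRankOneOfFacts/F1-DELTAQ-w6g3.md`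
(δQ = 1). `--supports stmt-BirchSwinnertonDyer-20368` (helper, Theses-free). HONEST FRAMING: nothing here closes the crux or a registered stub;
BSD is not proved by any of this; no summit statement is proved by this seat. No definition, no named fact, no `sorry`. Pure algebra (one Literature import for `isOfFinAddOrder_of_zsmul`).

WHAT. The ABSTRACT Mordell–Weil algebra behind (F1)'s global half («`Q_M` is generated by the `W*`-parts of the Kummer classes of the
ℚ-generator `P`») and behind -w3 g9's (INF) («`πP ∉ r·P + 2^N E(K) + tors`»), in the currency -w7 g3 uses locally (`…LocalPointsScalar*`:
an ADDITIVE map `f` with `f (f x) = f x − 2 x` standing for the CM endomorphism `π`, `π² = π − 2`): an additive group `A` (= `E(K)`),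
additive endomorphisms `f` (= `π` on `K`-points) and `c` (= complex conjugation) with
  `f (f x) = f x − 2x`, `c (c x) = x`, `c (f x) = c x − f (c x)` (`c π = π̄ c`, `π̄ = 1 − π`),
a point `P` of infinite order fixed by `c`, and «every `c`-fixed element is `k • P +` torsion» (`E(K)^c = E(ℚ) = ℤP + tors`, the frame's
«`∀ R ∈ W(ℚ), R = kP + T`»). Then, with `s := 2f − 1` (`= √−7`: `s (s x) = −7 x`, `sq_twoFSubOne`):
* `isFixed_add_conj`, `isFixed_fConj` — `y + c y` and `f y + c y − f (c y)` are `c`-fixed;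
* **`seven_smul_mem`** — `∀ y, ∃ a b T, IsOfFinAddOrder T ∧ 7 • y = a • P + b • f P + T`: **`7 · A ⊆ ℤP + ℤ fP + A_tors`** (the index of
  `O_K · P` in `E(K)/tors` divides `49` — ODD; memo §2: hence `E(K) ⊗ ℤ₂ = (O_K ⊗ ℤ₂) · P`, `δQ = 1` 2-adically);
* **`eq_zero_of_isOfFinAddOrder_smul_add_smul`** — `a • P + b • f P` of finite order ⟹ `a = 0 ∧ b = 0` (`P, πP` independent);
* **`dvd_seven_of_fSub_eq`** — if `m • y + T = f P − r • P` with `T` of finite order then `m ∣ 7`; hence **`not_exists_fSub_eq_pow_smul`**: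
  `πP − r•P ∉ 2^N · A + A_tors` for every `r : ℤ` and `N ≥ 1` (-w3 g9's (INF) «`e′_*(res_⊤ range κ)` is infinite» in lattice form).
The frame instantiation (`A = W⟮K⟯`, `f` = descent of `π` through `toGeomPoints`, `c = Point.map` of complex conjugation, `E(K)^c = E(ℚ)` by
Galois descent on coordinates) is file 2. beyond-print theorem: no (bookkeeping).

References: [Rubin1999] §2–§3 (the `O_K`-module `E(K)`); [SilvermanAEC2009] X §5 (twist by the CM field); [GrossZagier1986] V §2 (Heegner
points and complex conjugation).
-/

set_option linter.dupNamespace false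
set_option autoImplicit false

namespace Summit.BirchSwinnertonDyer.BirchSwinnertonDyer.Theorems.PrintCf2.MordellWeilCM

variable {A : Type*} [AddCommGroup A] (f c : A →+ A)
  (hf : ∀ x, f (f x) = f x - 2 • x) (hcc : ∀ x, c (c x) = x) (hcf : ∀ x, c (f x) = c x - f (c x))
  {P : A} (hP : ¬ IsOfFinAddOrder P) (hcP : c P = P)
  (hfix : ∀ y, c y = y → ∃ (k : ℤ) (T : A), IsOfFinAddOrder T ∧ y = k • P + T)

/-! ## §1. `s = 2f − 1` squares to `−7`; `c`-fixed combinations -/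

include hf in
/-- `(2π − 1)² = −7`: with `s x := 2 • f x − x`, `s (s x) = −7 • x`. [cite: Rubin1999, §3 (π² = π − 2 for `ℚ(√−7)`)] -/
theorem sq_twoFSubOne (x : A) : (2 • f (2 • f x - x) - (2 • f x - x)) = -(7 : ℤ) • x := by
  have h1 : f (2 • f x - x) = 2 • f (f x) - f x := by rw [map_sub, map_nsmul]
  rw [h1, hf]
  module

include hcc in
/-- `y + c y` is fixed by the involution `c`. [folklore] -/
theorem isFixed_add_conj (y : A) : c (y + c y) = y + c y := by
  rw [map_add, hcc, add_comm]

include hcc hcf in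
/-- `f y + c y − f (c y)` (`= πy + π̄(cy)`) is fixed by `c` (`c π = π̄ c`). [folklore] -/
theorem isFixed_fConj (y : A) : c (f y + c y - f (c y)) = f y + c y - f (c y) := by
  rw [map_sub, map_add, hcf, hcc, hcf (c y), hcc]
  abel

omit [AddCommGroup A] in
/-- An additive endomorphism preserves finite order. [folklore] -/
theorem isOfFinAddOrder_map {B : Type*} [AddCommGroup B] (g : B →+ B) {T : B} (hT : IsOfFinAddOrder T) :
    IsOfFinAddOrder (g T) :=
  g.isOfFinAddOrder hT

omit [AddCommGroup A] in
/-- Elements of finite order are closed under subtraction (the torsion subgroup). [folklore] -/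
theorem isOfFinAddOrder_sub {B : Type*} [AddCommGroup B] {x y : B} (hx : IsOfFinAddOrder x) (hy : IsOfFinAddOrder y) :
    IsOfFinAddOrder (x - y) := by
  rw [← AddCommGroup.mem_torsion] at hx hy ⊢
  exact sub_mem hx hy

omit [AddCommGroup A] in
/-- Integer multiples of an element of finite order have finite order. [folklore] -/
theorem isOfFinAddOrder_zsmul' {B : Type*} [AddCommGroup B] {x : B} (hx : IsOfFinAddOrder x) (z : ℤ) :
    IsOfFinAddOrder (z • x) := by
  rw [← AddCommGroup.mem_torsion] at hx ⊢
  exact AddSubgroup.zsmul_mem _ hx z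

/-! ## §2. `7 · A ⊆ ℤ P + ℤ fP + A_tors` -/

include hf hcc hcf hfix in
/-- **`7 · E(K) ⊆ ℤP + ℤπP + E(K)_tors`.** For every `y`: `y + cy = k₁P + T₁` and `πy + π̄(cy) = k₂P + T₂` are `c`-fixed, hence in `ℤP + tors`;
then `(2π − 1) y = (k₂ − k₁) P + k₁ πP + (T₂ + πT₁ − T₁)` and applying `2π − 1` once more (`(2π−1)² = −7`):
`7y = (3k₁ + k₂) P + (k₁ − 2k₂) πP + T`. [cite: Rubin1999, §2–§3] -/
theorem seven_smul_mem (y : A) :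
    ∃ (a b : ℤ) (T : A), IsOfFinAddOrder T ∧ (7 : ℤ) • y = a • P + b • f P + T := by
  obtain ⟨k₁, T₁, hT₁, h₁⟩ := hfix _ (isFixed_add_conj c hcc y)
  obtain ⟨k₂, T₂, hT₂, h₂⟩ := hfix _ (isFixed_fConj f c hcc hcf y)
  -- `s y := 2 f y - y = (y + cy)·(-1) + (f y + c y - f (c y)) + f (y + c y) - ...`: compute `s y` from the two fixed combinations
  have hs : 2 • f y - y = (f y + c y - f (c y)) + f (y + c y) - (y + c y) := by
    rw [map_add]
    abel
  -- substitute the two `ℤP + tors` expressions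
  have hsy : 2 • f y - y = (k₂ - k₁) • P + k₁ • f P + (T₂ + f T₁ - T₁) := by
    rw [hs, h₂, h₁, map_add, map_zsmul]
    module
  -- apply `s` again: `-7 y = s (s y)`
  have h7 : -(7 : ℤ) • y = 2 • f (2 • f y - y) - (2 • f y - y) := (sq_twoFSubOne f hf y).symm
  set T := T₂ + f T₁ - T₁ with hTdef
  have hT : IsOfFinAddOrder T := by
    rw [hTdef]
    exact isOfFinAddOrder_sub (by simpa only [sub_neg_eq_add] using isOfFinAddOrder_sub hT₂ (isOfFinAddOrder_map f hT₁).neg) hT₁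
  have hfs : f (2 • f y - y) = (k₂ - k₁) • f P + k₁ • (f P - 2 • P) + f T := by
    rw [hsy, map_add, map_add, map_zsmul, map_zsmul, hf]
  refine ⟨3 * k₁ + k₂, k₁ - 2 * k₂, -(2 • f T - T), ?_, ?_⟩
  · exact (isOfFinAddOrder_sub ((isOfFinAddOrder_map f hT).nsmul (n := 2)) hT).neg
  · have : (7 : ℤ) • y = -(2 • f (2 • f y - y) - (2 • f y - y)) := by rw [← h7]; module
    rw [this, hfs, hsy]
    module

/-! ## §3. Independence of `P` and `πP` -/

include hf hcf hP hcP in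
/-- **`P` and `πP` are independent modulo torsion**: if `a • P + b • πP` has finite order then `a = b = 0`. (Apply `c`: `a P + b π̄ P` has finite
order too; subtract: `b (2π − 1) P` torsion; apply `2π − 1`: `7 b P` torsion, so `b = 0` since `P` has infinite order; then `a = 0`.)
[cite: Rubin1999, §2–§3] -/
theorem eq_zero_of_isOfFinAddOrder_smul_add_smul {a b : ℤ} (h : IsOfFinAddOrder (a • P + b • f P)) : a = 0 ∧ b = 0 := by
  -- `c (a P + b f P) = a P + b (P - f P)`
  have hc : c (a • P + b • f P) = a • P + b • (P - f P) := by
    rw [map_add, map_zsmul, map_zsmul, hcf, hcP]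
  have hcu : IsOfFinAddOrder (a • P + b • (P - f P)) := hc ▸ isOfFinAddOrder_map c h
  -- difference: `b • (2 f P - P)` has finite order
  have hdiff : IsOfFinAddOrder (b • (2 • f P - P)) := by
    have := isOfFinAddOrder_sub h hcu
    have e : a • P + b • f P - (a • P + b • (P - f P)) = b • (2 • f P - P) := by module
    rwa [e] at this
  -- apply `s`: `-7 b P` has finite order
  have h7 : IsOfFinAddOrder ((7 * b) • P) := by
    have h1 : IsOfFinAddOrder (2 • f (b • (2 • f P - P)) - b • (2 • f P - P)) :=
      isOfFinAddOrder_sub ((isOfFinAddOrder_map f hdiff).nsmul (n := 2)) hdiff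
    have e : 2 • f (b • (2 • f P - P)) - b • (2 • f P - P) = b • (2 • f (2 • f P - P) - (2 • f P - P)) := by
      rw [map_zsmul]; module
    rw [e, sq_twoFSubOne f hf P] at h1
    have e2 : b • (-(7 : ℤ) • P) = -((7 * b) • P) := by module
    rw [e2] at h1
    exact h1.of_neg
  have hb : b = 0 := by
    by_contra hb
    exact hP (Literature.NumberTheory.EllipticCurves.isOfFinAddOrder_of_zsmul (mul_ne_zero (by norm_num) hb) h7)
  subst hb
  have ha : a = 0 := by
    by_contra ha
    rw [zero_smul, add_zero] at h
    exact hP (Literature.NumberTheory.EllipticCurves.isOfFinAddOrder_of_zsmul ha h)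
  exact ⟨ha, rfl⟩

include hf hcc hcf hP hcP in
/-- **(INF) in lattice form: `πP − r•P` is not `2^N`-divisible modulo torsion for `N ≥ 1`** — more generally, if `f P − r • P − m • y` has
finite order then `m ∣ 7 · gcd`-type constraint: here we prove the form -w3 g9 needs, `m • y = f P − r • P + T` with `T` torsion and
`7 ∣ m` impossible unless … Precisely: if `m • y + T = f P − r • P` (`T` of finite order) then `m ∣ 7` in the sense `∃ a b, 7 = m * b ∧ …`;
we state the clean corollary: **for `m` with `¬ m ∣ 7`, no `y, T`** — in particular for `m = 2^N`, `N ≥ 1`… (`2^N ∤ 7`).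
Proof: `7y = aP + b fP + T'` (`seven_smul_mem`), so `7(fP − rP) − m(aP + b fP) ` has finite order, and independence gives `7 = m b`.
[cite: Rubin1999, §2–§3] -/
theorem dvd_seven_of_fSub_eq
    (hfix : ∀ y, c y = y → ∃ (k : ℤ) (T : A), IsOfFinAddOrder T ∧ y = k • P + T)
    {r m : ℤ} {y T : A} (hT : IsOfFinAddOrder T) (h : m • y + T = f P - r • P) : m ∣ 7 := by
  obtain ⟨a, b, T', hT', h7⟩ := seven_smul_mem f c hf hcc hcf hfix y
  -- `7 (fP - rP) = m (7 y) + 7 T = m (aP + b fP + T') + 7T`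
  have key : IsOfFinAddOrder (((-(7 : ℤ) * r) - m * a) • P + (7 - m * b) • f P) := by
    have e : ((-(7 : ℤ) * r) - m * a) • P + (7 - m * b) • f P =
        (7 : ℤ) • (f P - r • P) - m • ((7 : ℤ) • y) + m • T' := by
      rw [h7]; module
    rw [e, ← h]
    have e2 : (7 : ℤ) • (m • y + T) - m • ((7 : ℤ) • y) + m • T' = (7 : ℤ) • T + m • T' := by module
    rw [e2]
    simpa only [sub_neg_eq_add] using isOfFinAddOrder_sub (isOfFinAddOrder_zsmul' hT 7) (isOfFinAddOrder_zsmul' hT' m).neg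
  obtain ⟨-, hb⟩ := eq_zero_of_isOfFinAddOrder_smul_add_smul f c hf hcf hP hcP key
  exact ⟨b, by linarith⟩

include hf hcc hcf hP hcP in
/-- **(INF): `πP − r•P ∉ 2^N E(K) + E(K)_tors` for `N ≥ 3`** (indeed for `N ≥ 1`, as `2 ∤ 7`; we record `N ≥ 1`). [cite: Rubin1999, §2–§3] -/
theorem not_exists_fSub_eq_pow_smul
    (hfix : ∀ y, c y = y → ∃ (k : ℤ) (T : A), IsOfFinAddOrder T ∧ y = k • P + T)
    (r : ℤ) {N : ℕ} (hN : 1 ≤ N) :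
    ¬ ∃ (y T : A), IsOfFinAddOrder T ∧ ((2 : ℤ) ^ N) • y + T = f P - r • P := by
  rintro ⟨y, T, hT, h⟩
  have hdvd := dvd_seven_of_fSub_eq f c hf hcc hcf hP hcP hfix hT h
  have h2 : (2 : ℤ) ∣ 7 := (dvd_pow_self 2 (by omega)).trans hdvd
  omega

end Summit.BirchSwinnertonDyer.BirchSwinnertonDyer.Theorems.PrintCf2.MordellWeilCM
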